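import Mathlib
import Summits.NavierStokesRegularity.NavierStokesRegularity.Theorems.EulerZoomLiouvillePowerGaugeEulerLiouvilleForwardEscapeTrajectory
import HarnessLib

/-!
# Crux `EulerZoomLiouville.PowerGaugeEulerLiouville` (stmt-NavierStokesRegularity-19832): the inflowing trajectory (per-label half of plate t59-IN, nsreg-p2 ROUND-54)

Width/portrait helper for THE ONE STATEMENT `stub_selfSimilarC2Needle` (LEAD skeleton `Cruxes/PowerGaugeEulerLiouville/Lines/birth.lean` v111,
ns-typeII-p2 g16), `--supports stmt-NavierStokesRegularity-19832 --as helper`.  Text custody nsreg-p2 g44 (`r54/Sketch54.lean` f78682d2f4ee3f27,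
`NsregP2.R54.Trace.InflowLaw` — the backward twin of `ForwardEscapeLaw`; keys 09:01:11Z/09:04:21Z).  In the lineage's cut-off idiom
(`V ∈ C²`, `‖DV‖ ≤ K`, flow `Ψ_s = ODE.evolutionMap (fun _ => selfSimilarTransport γ 0 V) 0 s` of `W = γy + V`):

* `measurableSet_stayProd_of_continuous` / `measurableSet_stayUntilProd_of_continuous` — the sets `{(y,σ) : ∀σ″∈[0,σ], ‖Θ y σ″‖ ≤ f σ″}` and
  `{(y,t) : ∀τ∈[t,S], ‖Θ y τ‖ ≤ f τ}` are measurable for any jointly continuous `Θ` and continuous `f` (rational times; time reflection);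
* `exists_inward_crossing_times` — if the physical radius `e^{−γt}‖Ψ_t z‖` is `≥ D` at some `t₀ ∈ [0,S]` and `≤ D/2` at the horizon `S`, there are
  a LAST time `t₁` at level `D` and a FIRST later time `t₃` at level `≤ D/2`, `0 ≤ t₁ < t₃ ≤ S`, with the radius `≤ D` on `[t₁, S]`;
* `sq_le_lintegral_inflow` — hence `(D/2)² ≤ ∫_{[0,S]} 𝟙{radius ≤ D on [t,S]} e^{(1−2γ)t}‖V(Ψ_t z)‖² dt` (FTC for the physical position
  `Trace.hasDerivAt_physicalPosition`, Cauchy–Schwarz in time with `e^{−t}·e^{(1−2γ)t}`, `∫_{t₁}^{t₃}e^{−t} ≤ 1`).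

HONEST FRAMING: kinematics of HYPOTHETICAL profiles' cut-off flows; nothing about the crux E (19832 OPEN) or NS regularity is proved here.
[nsreg-p2 R54 §C t59-IN; cite: ConstantinIgnatovaVicol2026Putative, §3.4.1 eq. (3.21)]
-/

noncomputable section

set_option linter.dupNamespace false

open MeasureTheory Set Filter Topology Metric Function
open scoped RealInnerProductSpace NNReal ENNReal ContDiff

namespace Summit.NavierStokesRegularity.NavierStokesRegularity.Theorems.PowerGaugeEulerLiouville.Trace

open Literature.Analysis Literature.Analysis.FluidPDE
open Summit.NavierStokesRegularity.NavierStokesRegularity.Theorems.PowerGaugeEulerLiouville.BernoulliLandscape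
open Summit.NavierStokesRegularity.NavierStokesRegularity.Theorems.PowerGaugeEulerLiouville.NeedleFeeding

variable {γ : ℝ} {V : EuclideanSpace ℝ (Fin 3) → EuclideanSpace ℝ (Fin 3)} {K : ℝ}

/-! ### Measurability of stay sets for a jointly continuous motion -/

/-- For a jointly continuous motion `Θ` and a continuous radius profile `f`, the stay set `{(y, σ) : ∀ σ″ ∈ [0, σ], ‖Θ y σ″‖ ≤ f σ″}` is
measurable (rational times plus the endpoint; continuity in time). [folklore] -/
theorem measurableSet_stayProd_of_continuous {Θ : EuclideanSpace ℝ (Fin 3) → ℝ → EuclideanSpace ℝ (Fin 3)}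
    (hΘ : Continuous fun p : EuclideanSpace ℝ (Fin 3) × ℝ => Θ p.1 p.2) {f : ℝ → ℝ} (hf : Continuous f) :
    MeasurableSet {p : EuclideanSpace ℝ (Fin 3) × ℝ | ∀ σ ∈ Icc 0 p.2, ‖Θ p.1 σ‖ ≤ f σ} := by
  have heq : {p : EuclideanSpace ℝ (Fin 3) × ℝ | ∀ σ ∈ Icc 0 p.2, ‖Θ p.1 σ‖ ≤ f σ} =
      (⋂ q : ℚ, ({p : EuclideanSpace ℝ (Fin 3) × ℝ | (q : ℝ) < 0} ∪ {p | p.2 < q} ∪ {p | ‖Θ p.1 q‖ ≤ f q})) ∩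
      ({p : EuclideanSpace ℝ (Fin 3) × ℝ | p.2 < 0} ∪ {p | ‖Θ p.1 p.2‖ ≤ f p.2}) := by
    ext p
    simp only [mem_inter_iff, mem_iInter, mem_union, mem_setOf_eq]
    constructor
    · intro hst
      refine ⟨fun q => ?_, ?_⟩
      · by_cases h1 : (q : ℝ) < 0
        · exact Or.inl (Or.inl h1)
        · by_cases h2 : p.2 < q
          · exact Or.inl (Or.inr h2)
          · exact Or.inr (hst q ⟨not_lt.1 h1, not_lt.1 h2⟩)
      · by_cases h0 : p.2 < 0
        · exact Or.inl h0
        · exact Or.inr (hst p.2 ⟨not_lt.1 h0, le_rfl⟩)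
    · rintro ⟨hQ', hC'⟩ σ hσ
      rcases eq_or_lt_of_le hσ.2 with hσeq | hσlt
      · rcases hC' with h0 | h
        · exact absurd (hσ.1.trans hσ.2) (not_le.2 h0)
        · rw [hσeq]; exact h
      · by_contra hgt
        push Not at hgt
        have hcont : Continuous fun τ : ℝ => ‖Θ p.1 τ‖ - f τ :=
          (hΘ.comp (continuous_const.prodMk continuous_id)).norm.sub hf
        have hgt' : 0 < ‖Θ p.1 σ‖ - f σ := sub_pos.2 hgt
        obtain ⟨ε, hε, hball⟩ :=
          Metric.eventually_nhds_iff.1 (hcont.continuousAt.eventually (lt_mem_nhds hgt'))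
        obtain ⟨q, hq1, hq2⟩ := exists_rat_btwn (lt_min hσlt (lt_add_of_pos_right σ hε))
        have hqσ : σ < q := hq1
        have hq_ball : dist (q : ℝ) σ < ε := by
          rw [Real.dist_eq, abs_of_pos (sub_pos.2 hqσ)]
          linarith [hq2.trans_le (min_le_right _ _)]
        rcases hQ' q with (h | h) | h
        · exact absurd (hσ.1.trans_lt hqσ) (not_lt.2 h.le)
        · exact absurd (hq2.trans_le (min_le_left _ _)) (not_lt.2 h.le)
        · exact absurd (sub_pos.1 (hball hq_ball)) (not_lt.2 h)
  rw [heq]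
  refine (MeasurableSet.iInter fun q => ?_).inter
    ((measurableSet_lt measurable_snd measurable_const).union
      (measurableSet_le hΘ.norm.measurable (hf.measurable.comp measurable_snd)))
  refine (MeasurableSet.union ?_ (measurableSet_lt measurable_snd measurable_const)).union
    (measurableSet_le (hΘ.comp (continuous_fst.prodMk continuous_const)).norm.measurable measurable_const)
  by_cases h : (q : ℝ) < 0
  · simp only [h, setOf_true]; exact MeasurableSet.univ
  · simp only [h, setOf_false]; exact MeasurableSet.empty

/-- For a jointly continuous motion `Θ`, a continuous radius profile `f` and a horizon `S`, the «stay until the horizon» set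
`{(y, t) : ∀ τ ∈ [t, S], ‖Θ y τ‖ ≤ f τ}` is measurable (time reflection `τ = S − u` of `measurableSet_stayProd_of_continuous`). [folklore] -/
theorem measurableSet_stayUntilProd_of_continuous {Θ : EuclideanSpace ℝ (Fin 3) → ℝ → EuclideanSpace ℝ (Fin 3)}
    (hΘ : Continuous fun p : EuclideanSpace ℝ (Fin 3) × ℝ => Θ p.1 p.2) {f : ℝ → ℝ} (hf : Continuous f) (S : ℝ) :
    MeasurableSet {p : EuclideanSpace ℝ (Fin 3) × ℝ | ∀ τ ∈ Icc p.2 S, ‖Θ p.1 τ‖ ≤ f τ} := by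
  have hΘ' : Continuous fun p : EuclideanSpace ℝ (Fin 3) × ℝ => Θ p.1 (S - p.2) :=
    hΘ.comp (continuous_fst.prodMk (continuous_const.sub continuous_snd))
  have hm := measurableSet_stayProd_of_continuous (Θ := fun y u => Θ y (S - u)) hΘ' (f := fun u => f (S - u)) (by fun_prop)
  have heq : {p : EuclideanSpace ℝ (Fin 3) × ℝ | ∀ τ ∈ Icc p.2 S, ‖Θ p.1 τ‖ ≤ f τ} =
      (fun p : EuclideanSpace ℝ (Fin 3) × ℝ => (p.1, S - p.2)) ⁻¹'
        {p : EuclideanSpace ℝ (Fin 3) × ℝ | ∀ u ∈ Icc 0 p.2, ‖Θ p.1 (S - u)‖ ≤ f (S - u)} := by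
    ext p
    simp only [mem_preimage, mem_setOf_eq]
    constructor
    · intro h u hu
      exact h (S - u) ⟨by linarith [hu.2], by linarith [hu.1]⟩
    · intro h τ hτ
      have := h (S - τ) ⟨by linarith [hτ.2], by linarith [hτ.1]⟩
      simpa only [sub_sub_cancel] using this
  rw [heq]
  exact (measurable_fst.prodMk (measurable_const.sub measurable_snd)) hm

/-! ### Last time at level `D`, first later time at level `D/2` -/

/-- **Inward crossing times.**  If the physical radius `e^{−γt}‖Ψ_t z‖` is `≥ D` at some `t₀ ∈ [0, S]` and `≤ D/2` at the horizon `S` (`D > 0`),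
then there are `0 ≤ t₁ < t₃ ≤ S` with: the radius is `≤ D` on `[t₁, S]`, `≥ D` at `t₁`, and `≤ D/2` at `t₃`
(`t₁` = last time at level `≥ D` = `sSup`, `t₃` = first time after `t₁` at level `≤ D/2` = `sInf`; continuity of the orbit). [folklore] -/
theorem exists_inward_crossing_times (hV : ContDiff ℝ 2 V) (hK : ∀ y, ‖fderiv ℝ V y‖ ≤ K) {D S : ℝ} (hD : 0 < D)
    {z : EuclideanSpace ℝ (Fin 3)}
    (hend : Real.exp (-γ * S) * ‖ODE.evolutionMap (fun _ : ℝ => selfSimilarTransport γ 0 V) 0 S z‖ ≤ D / 2)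
    (hfar : ∃ t ∈ Icc 0 S, D ≤ Real.exp (-γ * t) * ‖ODE.evolutionMap (fun _ : ℝ => selfSimilarTransport γ 0 V) 0 t z‖) :
    ∃ t₁ t₃ : ℝ, 0 ≤ t₁ ∧ t₁ < t₃ ∧ t₃ ≤ S ∧
      (∀ τ ∈ Icc t₁ S, Real.exp (-γ * τ) * ‖ODE.evolutionMap (fun _ : ℝ => selfSimilarTransport γ 0 V) 0 τ z‖ ≤ D) ∧
      D ≤ Real.exp (-γ * t₁) * ‖ODE.evolutionMap (fun _ : ℝ => selfSimilarTransport γ 0 V) 0 t₁ z‖ ∧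
      Real.exp (-γ * t₃) * ‖ODE.evolutionMap (fun _ : ℝ => selfSimilarTransport γ 0 V) 0 t₃ z‖ ≤ D / 2 := by
  obtain ⟨g, hg⟩ : ∃ g : ℝ → ℝ, g = fun s => Real.exp (-γ * s) *
      ‖ODE.evolutionMap (fun _ : ℝ => selfSimilarTransport γ 0 V) 0 s z‖ := ⟨_, rfl⟩
  have hgc : Continuous g := hg ▸ continuous_physicalRadius (γ := γ) hV hK z
  have hgS : g S ≤ D / 2 := by rw [hg]; exact hend
  -- last time at level `≥ D`
  obtain ⟨A, hA⟩ : ∃ A : Set ℝ, A = {t | t ∈ Icc 0 S ∧ D ≤ g t} := ⟨_, rfl⟩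
  have hAc : IsClosed A := hA ▸ isClosed_Icc.inter (isClosed_le continuous_const hgc)
  have hAne : A.Nonempty := by
    obtain ⟨t, ht, htD⟩ := hfar
    exact ⟨t, hA ▸ ⟨ht, by rw [hg]; exact htD⟩⟩
  have hAbdd : BddAbove A := ⟨S, fun t ht => (hA ▸ ht).1.2⟩
  set t₁ := sSup A with ht₁
  have ht₁A : t₁ ∈ A := hAc.csSup_mem hAne hAbdd
  have ht₁' := hA ▸ ht₁A
  have hlt₁ : ∀ τ, t₁ < τ → τ ≤ S → g τ < D := by
    intro τ h1 h2
    by_contra h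
    push Not at h
    have hτA : τ ∈ A := hA ▸ ⟨⟨ht₁'.1.1.trans h1.le, h2⟩, h⟩
    exact absurd (le_csSup hAbdd hτA) (not_le.2 h1)
  have ht₁S : t₁ < S := by
    rcases eq_or_lt_of_le ht₁'.1.2 with h | h
    · exfalso
      have h1 := ht₁'.2
      rw [h] at h1
      linarith
    · exact h
  -- the radius is `≤ D` on `[t₁, S]` (closure of `(t₁, S]`)
  have hle₁ : ∀ τ ∈ Icc t₁ S, g τ ≤ D := by
    have hZ : IsClosed {τ : ℝ | g τ ≤ D} := isClosed_le hgc continuous_const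
    have hsub : Ioc t₁ S ⊆ {τ : ℝ | g τ ≤ D} := fun τ hτ => (hlt₁ τ hτ.1 hτ.2).le
    have hcl : closure (Ioc t₁ S) ⊆ {τ : ℝ | g τ ≤ D} := hZ.closure_subset_iff.2 hsub
    rw [closure_Ioc ht₁S.ne] at hcl
    exact fun τ hτ => hcl hτ
  -- first time after `t₁` at level `≤ D/2`
  obtain ⟨B, hB⟩ : ∃ B : Set ℝ, B = {t | t ∈ Icc t₁ S ∧ g t ≤ D / 2} := ⟨_, rfl⟩
  have hBc : IsClosed B := hB ▸ isClosed_Icc.inter (isClosed_le hgc continuous_const)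
  have hSB : S ∈ B := hB ▸ ⟨⟨ht₁S.le, le_rfl⟩, hgS⟩
  have hBne : B.Nonempty := ⟨S, hSB⟩
  have hBbdd : BddBelow B := ⟨t₁, fun t ht => (hB ▸ ht).1.1⟩
  set t₃ := sInf B with ht₃
  have ht₃B : t₃ ∈ B := hBc.csInf_mem hBne hBbdd
  have ht₃' := hB ▸ ht₃B
  have ht₁t₃ : t₁ < t₃ := by
    rcases eq_or_lt_of_le ht₃'.1.1 with h | h
    · exfalso
      have h1 := ht₁'.2
      have h3 := ht₃'.2
      rw [← h] at h3
      linarith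
    · exact h
  refine ⟨t₁, t₃, ht₁'.1.1, ht₁t₃, ht₃'.1.2, ?_, ?_, ?_⟩
  · intro τ hτ; have := hle₁ τ hτ; rw [hg] at this; exact this
  · have := ht₁'.2; rw [hg] at this; exact this
  · have := ht₃'.2; rw [hg] at this; exact this

/-! ### The inflowing trajectory pays `(D/2)²` of weighted kinetic time-integral -/

/-- **The inflowing trajectory.**  If the physical radius of the orbit of `z` is `≥ D` at some time in `[0, S]` (`D e^{γt} ≤ ‖Ψ_t z‖`) and
`≤ D/2` at the horizon `S`, then `(D/2)² ≤ ∫_{[0,S]} 𝟙{∀τ∈[t,S]: ‖Ψ_τ z‖ ≤ De^{γτ}} · e^{(1−2γ)t}‖V(Ψ_t z)‖² dt` (in `ℝ≥0∞`): the inward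
displacement through the annulus `(D/2, D)` is `≤ ∫_{t₁}^{t₃} e^{−γt}‖V(Ψ_t z)‖dt` (FTC) and Cauchy–Schwarz in time with `∫_{t₁}^{t₃}e^{−t} ≤ 1`.
[nsreg-p2 R54 §C t59-IN; cite: ConstantinIgnatovaVicol2026Putative, §3.4.1 eq. (3.21)] -/
theorem sq_le_lintegral_inflow (hV : ContDiff ℝ 2 V) (hK : ∀ y, ‖fderiv ℝ V y‖ ≤ K) {D S : ℝ} (hD : 0 < D)
    {z : EuclideanSpace ℝ (Fin 3)}
    (hend : ‖ODE.evolutionMap (fun _ : ℝ => selfSimilarTransport γ 0 V) 0 S z‖ ≤ D / 2 * Real.exp (γ * S))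
    (hfar : ∃ t ∈ Icc 0 S, D * Real.exp (γ * t) ≤ ‖ODE.evolutionMap (fun _ : ℝ => selfSimilarTransport γ 0 V) 0 t z‖) :
    ENNReal.ofReal ((D / 2) ^ 2) ≤ ∫⁻ t in Icc 0 S,
      indicator {t' : ℝ | ∀ τ ∈ Icc t' S,
          ‖ODE.evolutionMap (fun _ : ℝ => selfSimilarTransport γ 0 V) 0 τ z‖ ≤ D * Real.exp (γ * τ)}
        (fun t' => ENNReal.ofReal (Real.exp ((1 - 2 * γ) * t')) *
          ‖V (ODE.evolutionMap (fun _ : ℝ => selfSimilarTransport γ 0 V) 0 t' z)‖ₑ ^ 2) t := by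
  obtain ⟨Φ, hΦ⟩ : ∃ Φ : ℝ → EuclideanSpace ℝ (Fin 3) → EuclideanSpace ℝ (Fin 3),
      Φ = ODE.evolutionMap (fun _ : ℝ => selfSimilarTransport γ (0 : EuclideanSpace ℝ (Fin 3)) V) 0 := ⟨_, rfl⟩
  have hconv : ∀ (s : ℝ) (w : EuclideanSpace ℝ (Fin 3)), D * Real.exp (γ * s) ≤ ‖w‖ ↔ D ≤ Real.exp (-γ * s) * ‖w‖ := by
    intro s w
    have hpos : 0 < Real.exp (γ * s) := Real.exp_pos _
    have e : Real.exp (-γ * s) * ‖w‖ = ‖w‖ / Real.exp (γ * s) := by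
      rw [show -γ * s = -(γ * s) by ring, Real.exp_neg, div_eq_inv_mul]
    rw [e, le_div_iff₀ hpos]
  have hconv' : ∀ (s c : ℝ) (w : EuclideanSpace ℝ (Fin 3)), ‖w‖ ≤ c * Real.exp (γ * s) ↔ Real.exp (-γ * s) * ‖w‖ ≤ c := by
    intro s c w
    have hpos : 0 < Real.exp (γ * s) := Real.exp_pos _
    have e : Real.exp (-γ * s) * ‖w‖ = ‖w‖ / Real.exp (γ * s) := by
      rw [show -γ * s = -(γ * s) by ring, Real.exp_neg, div_eq_inv_mul]
    rw [e, div_le_iff₀ hpos]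
  have hend' : Real.exp (-γ * S) * ‖ODE.evolutionMap (fun _ : ℝ => selfSimilarTransport γ 0 V) 0 S z‖ ≤ D / 2 :=
    (hconv' S (D / 2) _).1 hend
  have hfar' : ∃ t ∈ Icc 0 S, D ≤ Real.exp (-γ * t) * ‖ODE.evolutionMap (fun _ : ℝ => selfSimilarTransport γ 0 V) 0 t z‖ := by
    obtain ⟨t, ht, h⟩ := hfar
    exact ⟨t, ht, (hconv t _).1 h⟩
  obtain ⟨t₁, t₃, ht₁, h13, ht₃S, hstay, hlev₁, hlev₃⟩ := exists_inward_crossing_times (γ := γ) hV hK hD hend' hfar'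
  rw [← hΦ] at hstay hlev₁ hlev₃ ⊢
  -- Step 1: FTC for the physical position, `D/2 ≤ ∫_{t₁}^{t₃} e^{−γt}‖V(Ψ_t z)‖`
  have hderiv : ∀ s ∈ uIcc t₁ t₃, HasDerivAt (fun r : ℝ => Real.exp (-γ * r) • Φ r z)
      (Real.exp (-γ * s) • V (Φ s z)) s := fun s _ => by
    rw [hΦ]; exact hasDerivAt_physicalPosition (γ := γ) hV hK z s
  have hcv : Continuous fun s : ℝ => Real.exp (-γ * s) • V (Φ s z) := by
    rw [hΦ]
    exact (by fun_prop : Continuous fun s : ℝ => Real.exp (-γ * s)).smul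
      (hV.continuous.comp (continuous_flow_time (γ := γ) hV hK z))
  have hFTC := intervalIntegral.integral_eq_sub_of_hasDerivAt hderiv (hcv.intervalIntegrable t₁ t₃)
  have hdisp : D / 2 ≤ ∫ s in t₁..t₃, Real.exp (-γ * s) * ‖V (Φ s z)‖ := by
    have h1 : D / 2 ≤ ‖Real.exp (-γ * t₃) • Φ t₃ z - Real.exp (-γ * t₁) • Φ t₁ z‖ := by
      have hn : ∀ s, ‖Real.exp (-γ * s) • Φ s z‖ = Real.exp (-γ * s) * ‖Φ s z‖ := fun s => by
        rw [norm_smul, Real.norm_of_nonneg (Real.exp_pos _).le]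
      have := norm_sub_norm_le (Real.exp (-γ * t₁) • Φ t₁ z) (Real.exp (-γ * t₃) • Φ t₃ z)
      rw [hn, hn, norm_sub_rev] at this
      linarith
    rw [← hFTC] at h1
    refine h1.trans ((intervalIntegral.norm_integral_le_integral_norm h13.le).trans (le_of_eq ?_))
    refine intervalIntegral.integral_congr fun s _ => ?_
    simp only [norm_smul, Real.norm_of_nonneg (Real.exp_pos _).le]
  -- Step 2: pass to `ℝ≥0∞` and Cauchy–Schwarz in time
  have hcn : Continuous fun s : ℝ => Real.exp (-γ * s) * ‖V (Φ s z)‖ := by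
    rw [hΦ]
    exact (by fun_prop : Continuous fun s : ℝ => Real.exp (-γ * s)).mul
      (hV.continuous.comp (continuous_flow_time (γ := γ) hV hK z)).norm
  have hint : IntegrableOn (fun s : ℝ => Real.exp (-γ * s) * ‖V (Φ s z)‖) (Ioc t₁ t₃) volume :=
    (hcn.continuousOn.integrableOn_compact isCompact_Icc).mono_set Ioc_subset_Icc_self
  have hD2 : ENNReal.ofReal (D / 2) ≤ ∫⁻ s in Ioc t₁ t₃, ENNReal.ofReal (Real.exp (-γ * s) * ‖V (Φ s z)‖) := by
    rw [← ofReal_integral_eq_lintegral_ofReal hint (ae_of_all _ fun s =>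
      mul_nonneg (Real.exp_pos _).le (norm_nonneg _)), ← intervalIntegral.integral_of_le h13.le]
    exact ENNReal.ofReal_le_ofReal hdisp
  have hsplit : ∀ s, ENNReal.ofReal (Real.exp (-γ * s) * ‖V (Φ s z)‖) =
      ENNReal.ofReal (Real.exp (-(s / 2))) * ENNReal.ofReal (Real.exp (s / 2) * (Real.exp (-γ * s) * ‖V (Φ s z)‖)) := by
    intro s
    rw [← ENNReal.ofReal_mul (Real.exp_pos _).le]
    congr 1
    rw [show Real.exp (-(s / 2)) * (Real.exp (s / 2) * (Real.exp (-γ * s) * ‖V (Φ s z)‖)) =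
      (Real.exp (-(s / 2)) * Real.exp (s / 2)) * (Real.exp (-γ * s) * ‖V (Φ s z)‖) by ring, ← Real.exp_add]
    simp
  have hm1 : AEMeasurable (fun s : ℝ => ENNReal.ofReal (Real.exp (-(s / 2)))) (volume.restrict (Ioc t₁ t₃)) :=
    (ENNReal.measurable_ofReal.comp (by fun_prop : Measurable fun s : ℝ => Real.exp (-(s / 2)))).aemeasurable
  have hcn2 : Continuous fun s : ℝ => Real.exp (s / 2) * (Real.exp (-γ * s) * ‖V (Φ s z)‖) :=
    (by fun_prop : Continuous fun s : ℝ => Real.exp (s / 2)).mul hcn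
  have hm2 : AEMeasurable (fun s : ℝ => ENNReal.ofReal (Real.exp (s / 2) * (Real.exp (-γ * s) * ‖V (Φ s z)‖)))
      (volume.restrict (Ioc t₁ t₃)) := (ENNReal.measurable_ofReal.comp hcn2.measurable).aemeasurable
  have hCS := ENNReal.lintegral_mul_le_Lp_mul_Lq (volume.restrict (Ioc t₁ t₃)) Real.HolderConjugate.two_two hm1 hm2
  have hLHS : ∫⁻ s in Ioc t₁ t₃, ENNReal.ofReal (Real.exp (-γ * s) * ‖V (Φ s z)‖) =
      ∫⁻ s in Ioc t₁ t₃, ((fun s : ℝ => ENNReal.ofReal (Real.exp (-(s / 2)))) *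
        fun s : ℝ => ENNReal.ofReal (Real.exp (s / 2) * (Real.exp (-γ * s) * ‖V (Φ s z)‖))) s :=
    lintegral_congr fun s => by rw [Pi.mul_apply]; exact hsplit s
  have e2 : ∀ x : ℝ≥0∞, x ^ (2 : ℝ) = x ^ 2 := fun x => by exact_mod_cast ENNReal.rpow_natCast x 2
  have hF1 : (∫⁻ s in Ioc t₁ t₃, ENNReal.ofReal (Real.exp (-(s / 2))) ^ (2 : ℝ)) ^ (1 / (2 : ℝ)) ≤ 1 := by
    have h : ∫⁻ s in Ioc t₁ t₃, ENNReal.ofReal (Real.exp (-(s / 2))) ^ (2 : ℝ) ≤ 1 := by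
      calc ∫⁻ s in Ioc t₁ t₃, ENNReal.ofReal (Real.exp (-(s / 2))) ^ (2 : ℝ)
          = ∫⁻ s in Ioc t₁ t₃, ENNReal.ofReal (Real.exp (-s)) := by
            refine lintegral_congr fun s => ?_
            rw [e2, ← ENNReal.ofReal_pow (Real.exp_pos _).le, ← Real.exp_nat_mul]
            congr 1
            push_cast
            ring
        _ ≤ 1 := lintegral_exp_neg_Ioc_le_one ht₁ h13.le
    calc (∫⁻ s in Ioc t₁ t₃, ENNReal.ofReal (Real.exp (-(s / 2))) ^ (2 : ℝ)) ^ (1 / (2 : ℝ))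
        ≤ (1 : ℝ≥0∞) ^ (1 / (2 : ℝ)) := ENNReal.rpow_le_rpow h (by norm_num)
      _ = 1 := ENNReal.one_rpow _
  have hG : ∀ s, ENNReal.ofReal (Real.exp (s / 2) * (Real.exp (-γ * s) * ‖V (Φ s z)‖)) ^ (2 : ℝ) =
      ENNReal.ofReal (Real.exp ((1 - 2 * γ) * s)) * ‖V (Φ s z)‖ₑ ^ 2 := by
    intro s
    rw [e2, ← ENNReal.ofReal_pow (by positivity),
      show (Real.exp (s / 2) * (Real.exp (-γ * s) * ‖V (Φ s z)‖)) ^ 2 =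
        (Real.exp (s / 2) * Real.exp (-γ * s)) ^ 2 * ‖V (Φ s z)‖ ^ 2 by ring,
      ← Real.exp_add, ← Real.exp_nat_mul, ENNReal.ofReal_mul (Real.exp_pos _).le, ENNReal.ofReal_pow (norm_nonneg _),
      ofReal_norm]
    congr 3
    push_cast
    ring
  have hmain : ENNReal.ofReal (D / 2) ≤
      (∫⁻ s in Ioc t₁ t₃, ENNReal.ofReal (Real.exp ((1 - 2 * γ) * s)) * ‖V (Φ s z)‖ₑ ^ 2) ^ (1 / (2 : ℝ)) := by
    have h := hD2.trans (hLHS.le.trans hCS)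
    simp_rw [hG] at h
    refine h.trans ?_
    calc (∫⁻ s in Ioc t₁ t₃, ENNReal.ofReal (Real.exp (-(s / 2))) ^ (2 : ℝ)) ^ (1 / (2 : ℝ)) *
          (∫⁻ s in Ioc t₁ t₃, ENNReal.ofReal (Real.exp ((1 - 2 * γ) * s)) * ‖V (Φ s z)‖ₑ ^ 2) ^ (1 / (2 : ℝ))
        ≤ 1 * (∫⁻ s in Ioc t₁ t₃, ENNReal.ofReal (Real.exp ((1 - 2 * γ) * s)) * ‖V (Φ s z)‖ₑ ^ 2) ^ (1 / (2 : ℝ)) :=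
          mul_le_mul_left hF1 _
      _ = _ := one_mul _
  have hsq : ENNReal.ofReal ((D / 2) ^ 2) ≤
      ∫⁻ s in Ioc t₁ t₃, ENNReal.ofReal (Real.exp ((1 - 2 * γ) * s)) * ‖V (Φ s z)‖ₑ ^ 2 := by
    have h := ENNReal.rpow_le_rpow hmain (by norm_num : (0 : ℝ) ≤ 2)
    rw [← ENNReal.rpow_mul, show (1 / (2 : ℝ)) * 2 = 1 by norm_num, ENNReal.rpow_one, e2,
      ← ENNReal.ofReal_pow (by positivity)] at h
    exact h
  calc ENNReal.ofReal ((D / 2) ^ 2)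
      ≤ ∫⁻ s in Ioc t₁ t₃, ENNReal.ofReal (Real.exp ((1 - 2 * γ) * s)) * ‖V (Φ s z)‖ₑ ^ 2 := hsq
    _ = ∫⁻ s in Ioc t₁ t₃, indicator {t' : ℝ | ∀ τ ∈ Icc t' S, ‖Φ τ z‖ ≤ D * Real.exp (γ * τ)}
          (fun t' => ENNReal.ofReal (Real.exp ((1 - 2 * γ) * t')) * ‖V (Φ t' z)‖ₑ ^ 2) s := by
        refine setLIntegral_congr_fun measurableSet_Ioc (fun s hs => ?_)
        rw [indicator_of_mem (show s ∈ {t' : ℝ | ∀ τ ∈ Icc t' S, ‖Φ τ z‖ ≤ D * Real.exp (γ * τ)} from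
          fun τ hτ => (hconv' τ D _).2 (hstay τ ⟨(le_of_lt hs.1).trans hτ.1, hτ.2⟩))]
    _ ≤ ∫⁻ s in Icc 0 S, indicator {t' : ℝ | ∀ τ ∈ Icc t' S, ‖Φ τ z‖ ≤ D * Real.exp (γ * τ)}
          (fun t' => ENNReal.ofReal (Real.exp ((1 - 2 * γ) * t')) * ‖V (Φ t' z)‖ₑ ^ 2) s :=
        lintegral_mono_set fun s hs => ⟨ht₁.trans hs.1.le, hs.2.trans ht₃S⟩

end Summit.NavierStokesRegularity.NavierStokesRegularity.Theorems.PowerGaugeEulerLiouville.Trace
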